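import Mathlib
import Summits.KontsevichZagierPeriods.Zeta5Search.Families.BasicGrowthDuality
import Summits.KontsevichZagierPeriods.Zeta5Search.Families.RayGrowth
import HarnessLib

/-!
# ζ(5) search — Families: DUALITY of the growth constant along a RAY — `1/M_{σ⁻¹}(β,α) = inf_{X_σ} F_σ(α,β)`

HONEST FRAMING: systematic search; no irrationality claim unless certified.  STRUCTURAL facts about the size of
Brown's generalised cellular integrals along exponent rays [Brown2016, §1.5 (1.4), §5.1–5.2] (seat P2, Families
layer); nothing about the arithmetic of any zeta value.

`Families/BasicGrowthDuality.lean` (all exponents equal) is extended to an arbitrary HOMOGENEOUS ray `(α, β)`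
[Brown2016, §5.1 (5.2)] — the shape of every designer family (Brown–Zudilin's 8-parameter integrals of `₈π₈^∨`,
VIM, `π¹⁰_odd`, …):
* `FRay σ α β z = ∏_i |z_i − z_{i+1}|^{α_i} / ∏_i |z_{σ_i} − z_{σ_{i+1}}|^{β_i}` — the projective ray function on
  finite real configurations;
* **`FRay_dual`** — for `σ ∘ τ = id`: `F_{τ;β,α}(z ∘ σ) = 1 / F_{σ;α,β}(z)`: the DUAL RAY of `(σ; α, β)` is
  `(σ⁻¹; β, α)` with the same position indexing (`homogeneous_dual`: it is homogeneous iff `(σ; α, β)` is);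
* `prod_edgeLaw_zpow` (weighted edge-law engine), **`FRay_moebius`** — under Brown's homogeneity (5.2) `F_{σ;α,β}`
  is `PGL₂(ℝ)`-invariant (this is exactly what (5.2) is for: the vertex weights `∏_v W_v^{α_{v−1}+α_v}` of numerator
  and denominator agree);
* **`rayF_eq_FRay_zOf`** — bridge to the simplicial `rayF σ α β` of `Families/RayGrowth.lean`;
* `image_FRay_stdCell` / **`raySup_eq_sSup_stdCell`** — `M_σ(α,β) = sup_{X_δ} F_{σ;α,β}`;
* `image_FRay_dualCell` / **`inv_raySup_dual_eq_sInf_dualCell`** / `raySup_dual_mul_sInf_dualCell` — for the dual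
  ray in Brown's cone: **`1/M_{σ⁻¹}(β,α) = inf_{X_σ} F_{σ;α,β}`**, `inv_raySup_dual_le_FRay`.
WHY THE CELL WANTS IT (numerical finding of this seat, `HOME/pub-zeta5-p2/g6/DUAL-RATES.md`, NOT asserted here): for
the Brown–Zudilin family the printed growth rate of the LEADING COEFFICIENTS `log|Q(a n)|/n → 85.08768883…` of the
record ray [BrownZudilin2022, §11] coincides to 13 digits with `log min_{X_{₈π₈^∨}} F_{₈π₈^∨;a}` = minus the log of
the growth constant of the DUAL RAY, and the same agreement (to the accuracy of the numerics) holds on eight further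
rays and exactly on the diagonal (`λ₃`, `Families/BasicGrowthDualityExtrema`).  Standard axioms only.
-/

noncomputable section

open Finset Set

namespace Summit.KontsevichZagierPeriods.Zeta5Search.Families.Cellular

variable {ℓ : ℕ} (σ : Fin (ℓ + 3) → Fin (ℓ + 3)) (α β : Fin (ℓ + 3) → ℤ)

/-! ### The projective ray function and its duality -/

/-- **The projective ray function** `F_{σ;α,β}(z) = ∏_i |z_i − z_{i+1}|^{α_i} / ∏_i |z_{σ_i} − z_{σ_{i+1}}|^{β_i}` of a
configuration of `n = ℓ + 3` finite real points (integer exponents on the edges of `δ⁰` resp. `σδ⁰`, by position).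
[Brown2016, §5.2 (5.4); structural] -/
def FRay (σ : Fin (ℓ + 3) → Fin (ℓ + 3)) (α β : Fin (ℓ + 3) → ℤ) (z : Fin (ℓ + 3) → ℝ) : ℝ :=
  (∏ i : Fin (ℓ + 3), |z i - z (i + 1)| ^ α i) / ∏ i : Fin (ℓ + 3), |z (σ i) - z (σ (i + 1))| ^ β i

/-- `0 ≤ F_{σ;α,β}(z)`. -/
theorem FRay_nonneg (z : Fin (ℓ + 3) → ℝ) : 0 ≤ FRay σ α β z :=
  div_nonneg (Finset.prod_nonneg fun _ _ => zpow_nonneg (abs_nonneg _) _)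
    (Finset.prod_nonneg fun _ _ => zpow_nonneg (abs_nonneg _) _)

/-- **Ray duality `(σ; α, β) ↔ (σ⁻¹; β, α)`**: if `σ ∘ τ = id` then `F_{τ;β,α}(z ∘ σ) = 1 / F_{σ;α,β}(z)` — the
`δ⁰`-edges of `w = z ∘ σ` are the `σδ⁰`-edges of `z` (same position), and the `τδ⁰`-edges of `w` are the `δ⁰`-edges
of `z`. -/
theorem FRay_dual {σ τ : Fin (ℓ + 3) → Fin (ℓ + 3)} (hστ : ∀ i, σ (τ i) = i) (z : Fin (ℓ + 3) → ℝ) :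
    FRay τ β α (z ∘ σ) = (FRay σ α β z)⁻¹ := by
  unfold FRay
  rw [inv_div]
  simp only [Function.comp_apply, hστ]

/-- Homogeneity is self-dual: if `(σ; α, β)` satisfies Brown's (5.2) then so does the dual ray `(σ⁻¹; β, α)`. -/
theorem homogeneous_dual {σ τ : Fin (ℓ + 3) → Fin (ℓ + 3)} (hστ : ∀ i, σ (τ i) = i) (hh : Homogeneous σ α β) :
    Homogeneous τ β α := by
  intro j
  have h := hh (τ j)
  rw [hστ] at h
  exact h.symm

/-! ### The weighted edge-law engine and `PGL₂`-invariance under homogeneity -/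

/-- **Weighted edge-law engine.**  If `E'(u,v)·(W u·W v) = E(u,v)·κ` for `u ≠ v` (non-vanishing weights), then for
an injective seating `σ` and integer exponents `γ` (by position) the cyclic weighted products satisfy
`∏_i E'(σ_i,σ_{i+1})^{γ_i} · ∏_i W(σ_i)^{γ_{i−1}+γ_i} = ∏_i E(σ_i,σ_{i+1})^{γ_i} · ∏_i κ^{γ_i}` — the vertex `σ_i` lies on
the two edges at positions `i − 1` and `i`. -/
theorem prod_edgeLaw_zpow {σ : Fin (ℓ + 3) → Fin (ℓ + 3)} (hσ : Function.Injective σ)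
    (E E' : Fin (ℓ + 3) → Fin (ℓ + 3) → ℝ) (W : Fin (ℓ + 3) → ℝ) (κ : ℝ) (γ : Fin (ℓ + 3) → ℤ)
    (hW : ∀ k, W k ≠ 0) (h : ∀ u v, u ≠ v → E' u v * (W u * W v) = E u v * κ) :
    (∏ i : Fin (ℓ + 3), E' (σ i) (σ (i + 1)) ^ γ i) * ∏ i : Fin (ℓ + 3), W (σ i) ^ (γ (i - 1) + γ i) =
      (∏ i : Fin (ℓ + 3), E (σ i) (σ (i + 1)) ^ γ i) * ∏ i : Fin (ℓ + 3), κ ^ γ i := by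
  have e1 : ∏ i : Fin (ℓ + 3), W (σ (i + 1)) ^ γ i = ∏ i : Fin (ℓ + 3), W (σ i) ^ γ (i - 1) :=
    Fintype.prod_equiv (Equiv.addRight 1) (fun i => W (σ (i + 1)) ^ γ i) (fun j => W (σ j) ^ γ (j - 1))
      fun i => by simp
  have e2 : ∏ i : Fin (ℓ + 3), W (σ i) ^ (γ (i - 1) + γ i) =
      (∏ i : Fin (ℓ + 3), W (σ (i + 1)) ^ γ i) * ∏ i : Fin (ℓ + 3), W (σ i) ^ γ i := by
    rw [e1, ← Finset.prod_mul_distrib]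
    exact Finset.prod_congr rfl fun i _ => zpow_add₀ (hW _) _ _
  rw [e2, ← Finset.prod_mul_distrib, ← Finset.prod_mul_distrib, ← Finset.prod_mul_distrib]
  refine Finset.prod_congr rfl fun i _ => ?_
  have hi := h (σ i) (σ (i + 1)) fun e => succ_ne_self i (hσ e)
  have hWW : W (σ i) * W (σ (i + 1)) ≠ 0 := mul_ne_zero (hW _) (hW _)
  have hE' : E' (σ i) (σ (i + 1)) = E (σ i) (σ (i + 1)) * κ / (W (σ i) * W (σ (i + 1))) := by
    rw [eq_div_iff hWW]; exact hi
  rw [hE', div_zpow, mul_zpow, mul_zpow, mul_comm (W (σ (i + 1)) ^ γ i)]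
  have hz : W (σ i) ^ γ i * W (σ (i + 1)) ^ γ i ≠ 0 :=
    mul_ne_zero (zpow_ne_zero _ (hW _)) (zpow_ne_zero _ (hW _))
  rw [div_mul_cancel₀ _ hz]

/-- Under homogeneity the vertex-weight products of numerator and denominator agree:
`∏_i X(σ_i)^{β_{i−1}+β_i} = ∏_v X(v)^{α_{v−1}+α_v}` (bijective `σ`). -/
theorem prod_vertexWeight_eq (hσ : Function.Bijective σ) (hh : Homogeneous σ α β) (X : Fin (ℓ + 3) → ℝ) :
    ∏ i : Fin (ℓ + 3), X (σ i) ^ (β (i - 1) + β i) = ∏ v : Fin (ℓ + 3), X v ^ (α (v - 1) + α v) := by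
  calc ∏ i : Fin (ℓ + 3), X (σ i) ^ (β (i - 1) + β i)
      = ∏ i : Fin (ℓ + 3), X (σ i) ^ (α (σ i - 1) + α (σ i)) :=
        Finset.prod_congr rfl fun i _ => by rw [hh i]
    _ = ∏ v : Fin (ℓ + 3), X v ^ (α (v - 1) + α v) :=
        Fintype.prod_equiv (Equiv.ofBijective σ hσ) _ (fun v => X v ^ (α (v - 1) + α v)) fun i => rfl

/-- Under homogeneity the total degrees agree: `∏_i κ^{β_i} = ∏_i κ^{α_i}` for `κ > 0` (from `2Σβ = 2Σα`). -/
theorem prod_zpow_deg_eq (hσ : Function.Bijective σ) (hh : Homogeneous σ α β) {κ : ℝ} (hκ : 0 < κ) :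
    ∏ i : Fin (ℓ + 3), κ ^ β i = ∏ i : Fin (ℓ + 3), κ ^ α i := by
  have h2 := prod_vertexWeight_eq σ α β hσ hh (fun _ => κ)
  have dbl : ∀ γ : Fin (ℓ + 3) → ℤ, ∏ i : Fin (ℓ + 3), κ ^ (γ (i - 1) + γ i) =
      (∏ i : Fin (ℓ + 3), κ ^ γ i) * ∏ i : Fin (ℓ + 3), κ ^ γ i := fun γ => by
    have e : ∏ i : Fin (ℓ + 3), κ ^ γ (i - 1) = ∏ i : Fin (ℓ + 3), κ ^ γ i :=
      Fintype.prod_equiv (Equiv.subRight 1) _ _ fun i => rfl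
    calc ∏ i : Fin (ℓ + 3), κ ^ (γ (i - 1) + γ i) = ∏ i : Fin (ℓ + 3), (κ ^ γ (i - 1) * κ ^ γ i) :=
          Finset.prod_congr rfl fun i _ => zpow_add₀ hκ.ne' _ _
      _ = (∏ i : Fin (ℓ + 3), κ ^ γ (i - 1)) * ∏ i : Fin (ℓ + 3), κ ^ γ i := Finset.prod_mul_distrib
      _ = _ := by rw [e]
  rw [dbl β, dbl α] at h2
  have hb : 0 < ∏ i : Fin (ℓ + 3), κ ^ β i := Finset.prod_pos fun i _ => zpow_pos hκ _
  have ha : 0 < ∏ i : Fin (ℓ + 3), κ ^ α i := Finset.prod_pos fun i _ => zpow_pos hκ _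
  rcases mul_self_eq_mul_self_iff.1 h2 with h | h
  · exact h
  · linarith

/-- **`PGL₂(ℝ)`-invariance of the projective ray function under Brown's homogeneity (5.2)**: for a bijective seating
`σ`, `Homogeneous σ α β`, and a Möbius map `g(x) = (a x + b)/(c x + d)` (`ad − bc ≠ 0`) finite on the configuration,
`F_{σ;α,β}(g ∘ z) = F_{σ;α,β}(z)`. [Brown2016, §5.1: "under (5.2) the integrand is `PGL₂`-invariant"] -/
theorem FRay_moebius (hσ : Function.Bijective σ) (hh : Homogeneous σ α β) (z : Fin (ℓ + 3) → ℝ) {a b c d : ℝ}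
    (hdet : a * d - b * c ≠ 0) (hz : ∀ k, c * z k + d ≠ 0) :
    FRay σ α β (fun k => (a * z k + b) / (c * z k + d)) = FRay σ α β z := by
  set g : Fin (ℓ + 3) → ℝ := fun k => (a * z k + b) / (c * z k + d) with hg
  have hW : ∀ k, |c * z k + d| ≠ 0 := fun k => abs_ne_zero.2 (hz k)
  have law : ∀ u v : Fin (ℓ + 3), u ≠ v →
      |g u - g v| * (|c * z u + d| * |c * z v + d|) = |z u - z v| * |a * d - b * c| := by
    intro u v _
    rw [← abs_mul, ← abs_mul, ← abs_mul, moebius_sub_mul (hz u) (hz v)]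
  have hnum := prod_edgeLaw_zpow (σ := id) Function.injective_id (fun u v => |z u - z v|)
    (fun u v => |g u - g v|) (fun k => |c * z k + d|) |a * d - b * c| α hW law
  have hden := prod_edgeLaw_zpow hσ.1 (fun u v => |z u - z v|) (fun u v => |g u - g v|)
    (fun k => |c * z k + d|) |a * d - b * c| β hW law
  simp only [id] at hnum
  have hv := prod_vertexWeight_eq σ α β hσ hh (fun v => |c * z v + d|)
  rw [hv, prod_zpow_deg_eq σ α β hσ hh (abs_pos.2 hdet)] at hden
  set P : ℝ := ∏ v : Fin (ℓ + 3), |c * z v + d| ^ (α (v - 1) + α v) with hP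
  set K : ℝ := ∏ i : Fin (ℓ + 3), |a * d - b * c| ^ α i with hK
  have hP0 : P ≠ 0 := Finset.prod_ne_zero_iff.2 fun v _ => zpow_ne_zero _ (hW v)
  have hK0 : K ≠ 0 := Finset.prod_ne_zero_iff.2 fun i _ => zpow_ne_zero _ (abs_ne_zero.2 hdet)
  have hA : (∏ i : Fin (ℓ + 3), |g i - g (i + 1)| ^ α i) =
      (∏ i : Fin (ℓ + 3), |z i - z (i + 1)| ^ α i) * (K / P) := by
    rw [← mul_div_assoc, eq_div_iff hP0]; exact hnum
  have hB : (∏ i : Fin (ℓ + 3), |g (σ i) - g (σ (i + 1))| ^ β i) =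
      (∏ i : Fin (ℓ + 3), |z (σ i) - z (σ (i + 1))| ^ β i) * (K / P) := by
    rw [← mul_div_assoc, eq_div_iff hP0]; exact hden
  unfold FRay
  rw [hA, hB, mul_div_mul_right _ _ (div_ne_zero hK0 hP0)]

/-! ### The bridge to the simplicial ray function -/

/-- **The bridge**: for a bijective homogeneous ray and `t` in the open simplex, `rayF σ α β t = F_{σ;α,β}(zOf t)`
(the vertex weights `wOf t` cancel by homogeneity; all total-degree factors are `1`). -/
theorem rayF_eq_FRay_zOf (hσ : Function.Bijective σ) (hh : Homogeneous σ α β) {t : Fin ℓ → ℝ}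
    (ht : t ∈ openSimplex ℓ) : rayF σ α β t = FRay σ α β (zOf t) := by
  have hW : ∀ k, wOf t k ≠ 0 := fun k => (wOf_pos ht k).ne'
  have law : ∀ u v : Fin (ℓ + 3), u ≠ v →
      |zOf t u - zOf t v| * (wOf t u * wOf t v) = ef t u v * 1 := fun u v huv => abs_zOf_sub_mul ht huv
  have hnum := prod_edgeLaw_zpow (σ := id) Function.injective_id (ef t) (fun u v => |zOf t u - zOf t v|)
    (wOf t) 1 α hW law
  have hden := prod_edgeLaw_zpow hσ.1 (ef t) (fun u v => |zOf t u - zOf t v|) (wOf t) 1 β hW law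
  simp only [id, one_zpow, Finset.prod_const_one, mul_one] at hnum hden
  have hv := prod_vertexWeight_eq σ α β hσ hh (wOf t)
  rw [hv] at hden
  set P : ℝ := ∏ v : Fin (ℓ + 3), wOf t v ^ (α (v - 1) + α v) with hP
  have hP0 : P ≠ 0 := Finset.prod_ne_zero_iff.2 fun v _ => zpow_ne_zero _ (hW v)
  unfold FRay rayF num den
  rw [← hnum, ← hden, mul_div_mul_right _ _ hP0]

/-! ### Cells: normal forms and the two extreme-value theorems -/

/-- Every increasing configuration is Möbius-equivalent to its normal form: `F_{σ;α,β}(z) = rayF σ α β (nfT z)`. -/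
theorem FRay_eq_rayF_nfT (hσ : Function.Bijective σ) (hh : Homogeneous σ α β) {z : Fin (ℓ + 3) → ℝ}
    (hz : StrictMono z) : FRay σ α β z = rayF σ α β (nfT z) := by
  calc FRay σ α β z = FRay σ α β (fun k => (nfA z * z k + nfB z) / (nfC z * z k + nfD z)) :=
        (FRay_moebius σ α β hσ hh z (nf_det_ne_zero hz) fun k => (nfC_mul_add_neg hz k).ne).symm
    _ = FRay σ α β (zOf (nfT z)) := by
        congr 1
        funext k
        exact nfG_apply hz k
    _ = rayF σ α β (nfT z) := (rayF_eq_FRay_zOf σ α β hσ hh (nfT_mem hz)).symm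

/-- **The dual cell**: for `σ ∘ τ = id = τ ∘ σ`, a homogeneous ray and increasing `w`, the configuration `w ∘ τ ∈ X_σ`
has `F_{σ;α,β}(w ∘ τ) = 1 / rayF τ β α (nfT w)` — the reciprocal of the DUAL ray's function at the normal form. -/
theorem FRay_comp_eq_inv {σ τ : Fin (ℓ + 3) → Fin (ℓ + 3)} (hστ : ∀ i, σ (τ i) = i) (hτσ : ∀ i, τ (σ i) = i)
    (hh : Homogeneous σ α β) {w : Fin (ℓ + 3) → ℝ} (hw : StrictMono w) :
    FRay σ α β (w ∘ τ) = (rayF τ β α (nfT w))⁻¹ := by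
  have hτ := bijective_of_inverse hστ hτσ
  have hσ : Function.Bijective σ := bijective_of_inverse hτσ hστ
  have hh' : Homogeneous τ β α := homogeneous_dual α β hστ hh
  calc FRay σ α β (w ∘ τ)
      = FRay σ α β (fun k => (nfA w * (w ∘ τ) k + nfB w) / (nfC w * (w ∘ τ) k + nfD w)) :=
        (FRay_moebius σ α β hσ hh (w ∘ τ) (nf_det_ne_zero hw) fun k => (nfC_mul_add_neg hw (τ k)).ne).symm
    _ = FRay σ α β (zOf (nfT w) ∘ τ) := by
        congr 1
        funext k
        exact nfG_apply hw (τ k)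
    _ = (FRay τ β α (zOf (nfT w)))⁻¹ := FRay_dual β α hτσ _
    _ = (rayF τ β α (nfT w))⁻¹ := by rw [← rayF_eq_FRay_zOf τ β α hτ hh' (nfT_mem hw)]

/-- The same for any `z` seated in the order `σ`: `F_{σ;α,β}(z) = 1 / rayF τ β α (nfT (z ∘ σ))`. -/
theorem FRay_eq_inv_rayF {σ τ : Fin (ℓ + 3) → Fin (ℓ + 3)} (hστ : ∀ i, σ (τ i) = i) (hτσ : ∀ i, τ (σ i) = i)
    (hh : Homogeneous σ α β) {z : Fin (ℓ + 3) → ℝ} (hz : StrictMono (z ∘ σ)) :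
    FRay σ α β z = (rayF τ β α (nfT (z ∘ σ)))⁻¹ := by
  have e : (z ∘ σ) ∘ τ = z := funext fun k => congrArg z (hστ k)
  calc FRay σ α β z = FRay σ α β ((z ∘ σ) ∘ τ) := by rw [e]
    _ = _ := FRay_comp_eq_inv α β hστ hτσ hh hz

/-- **The standard cell**: the values of `F_{σ;α,β}` on increasing configurations are exactly the values of
`rayF σ α β` on the open simplex. -/
theorem image_FRay_stdCell (hσ : Function.Bijective σ) (hh : Homogeneous σ α β) :
    FRay σ α β '' {z : Fin (ℓ + 3) → ℝ | StrictMono z} = rayF σ α β '' openSimplex ℓ := by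
  ext y
  constructor
  · rintro ⟨z, hz, rfl⟩
    exact ⟨nfT z, nfT_mem hz, (FRay_eq_rayF_nfT σ α β hσ hh hz).symm⟩
  · rintro ⟨t, ht, rfl⟩
    exact ⟨zOf t, zOf_strictMono ht, (rayF_eq_FRay_zOf σ α β hσ hh ht).symm⟩

/-- **`M_σ(α,β) = sup_{X_δ} F_{σ;α,β}`** — the ray growth constant as a supremum over all increasing real
configurations. -/
theorem raySup_eq_sSup_stdCell (hσ : Function.Bijective σ) (hh : Homogeneous σ α β) :
    raySup σ α β = sSup (FRay σ α β '' {z : Fin (ℓ + 3) → ℝ | StrictMono z}) := by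
  rw [image_FRay_stdCell σ α β hσ hh]
  rfl

/-- **The dual cell**: for `σ ∘ τ = id = τ ∘ σ` and a homogeneous ray, the values of `F_{σ;α,β}` on the configurations
seated in the order `σ` are exactly the reciprocals of the values of the dual ray function `rayF τ β α` on the simplex. -/
theorem image_FRay_dualCell {σ τ : Fin (ℓ + 3) → Fin (ℓ + 3)} (hστ : ∀ i, σ (τ i) = i) (hτσ : ∀ i, τ (σ i) = i)
    (hh : Homogeneous σ α β) :
    FRay σ α β '' {z : Fin (ℓ + 3) → ℝ | StrictMono (z ∘ σ)} = (fun t => (rayF τ β α t)⁻¹) '' openSimplex ℓ := by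
  have hτ := bijective_of_inverse hστ hτσ
  have hh' : Homogeneous τ β α := homogeneous_dual α β hστ hh
  ext y
  constructor
  · rintro ⟨z, hz, rfl⟩
    exact ⟨nfT (z ∘ σ), nfT_mem hz, (FRay_eq_inv_rayF α β hστ hτσ hh hz).symm⟩
  · rintro ⟨t, ht, rfl⟩
    refine ⟨zOf t ∘ τ, ?_, ?_⟩
    · have e : (zOf t ∘ τ) ∘ σ = zOf t := funext fun k => congrArg (zOf t) (hτσ k)
      show StrictMono ((zOf t ∘ τ) ∘ σ)
      rw [e]
      exact zOf_strictMono ht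
    · show FRay σ α β (zOf t ∘ τ) = (rayF τ β α t)⁻¹
      rw [FRay_dual β α hτσ, rayF_eq_FRay_zOf τ β α hτ hh' ht]

/-- **RAY DUALITY OF THE GROWTH CONSTANT: `1/M_{σ⁻¹}(β,α) = inf_{X_σ} F_{σ;α,β}`.**  For `σ ∘ τ = id = τ ∘ σ`, a
homogeneous ray `(σ; α, β)` whose DUAL ray `(τ; β, α)` lies in Brown's convergence cone, the reciprocal of the dual
ray's growth constant `raySup τ β α` is the infimum of `F_{σ;α,β}` over all real configurations seated in the order
`σ`. -/
theorem inv_raySup_dual_eq_sInf_dualCell {σ τ : Fin (ℓ + 3) → Fin (ℓ + 3)} (hστ : ∀ i, σ (τ i) = i)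
    (hτσ : ∀ i, τ (σ i) = i) (hh : Homogeneous σ α β)
    (hray : ∀ N : ℤ, 0 ≤ N → BrownConvergent τ (fun i => N * β i) (fun i => N * α i)) :
    (raySup τ β α)⁻¹ = sInf (FRay σ α β '' {z : Fin (ℓ + 3) → ℝ | StrictMono (z ∘ σ)}) := by
  have hτ := bijective_of_inverse hστ hτσ
  have hh' : Homogeneous τ β α := homogeneous_dual α β hστ hh
  rw [image_FRay_dualCell α β hστ hτσ hh, show (fun t => (rayF τ β α t)⁻¹) '' openSimplex ℓ =
    (fun x => x⁻¹) '' (rayF τ β α '' openSimplex ℓ) by rw [Set.image_image]]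
  exact (sInf_image_inv_eq ((openSimplex_nonempty ℓ).image _)
    (by rintro _ ⟨t, ht, rfl⟩; exact rayF_pos τ β α hτ.1 ht) (bddAbove_rayF_image τ β α hτ hh' hray)).symm

/-- Product form: **`M_{σ⁻¹}(β,α) · inf_{X_σ} F_{σ;α,β} = 1`**. -/
theorem raySup_dual_mul_sInf_dualCell {σ τ : Fin (ℓ + 3) → Fin (ℓ + 3)} (hστ : ∀ i, σ (τ i) = i)
    (hτσ : ∀ i, τ (σ i) = i) (hh : Homogeneous σ α β)
    (hray : ∀ N : ℤ, 0 ≤ N → BrownConvergent τ (fun i => N * β i) (fun i => N * α i)) :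
    raySup τ β α * sInf (FRay σ α β '' {z : Fin (ℓ + 3) → ℝ | StrictMono (z ∘ σ)}) = 1 := by
  have hτ := bijective_of_inverse hστ hτσ
  rw [← inv_raySup_dual_eq_sInf_dualCell α β hστ hτσ hh hray,
    mul_inv_cancel₀ (raySup_pos τ β α hτ (homogeneous_dual α β hστ hh) hray).ne']

/-- On the dual cell `F_{σ;α,β} ≥ 1/M_{σ⁻¹}(β,α)`. -/
theorem inv_raySup_dual_le_FRay {σ τ : Fin (ℓ + 3) → Fin (ℓ + 3)} (hστ : ∀ i, σ (τ i) = i)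
    (hτσ : ∀ i, τ (σ i) = i) (hh : Homogeneous σ α β)
    (hray : ∀ N : ℤ, 0 ≤ N → BrownConvergent τ (fun i => N * β i) (fun i => N * α i))
    {z : Fin (ℓ + 3) → ℝ} (hz : StrictMono (z ∘ σ)) : (raySup τ β α)⁻¹ ≤ FRay σ α β z := by
  have hτ := bijective_of_inverse hστ hτσ
  have hh' : Homogeneous τ β α := homogeneous_dual α β hστ hh
  rw [FRay_eq_inv_rayF α β hστ hτσ hh hz]
  exact inv_anti₀ (rayF_pos τ β α hτ.1 (nfT_mem hz)) (rayF_le_raySup τ β α hτ hh' hray (nfT_mem hz))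

/-- On the standard cell `F_{σ;α,β} ≤ M_σ(α,β)` (ray in Brown's cone). -/
theorem FRay_le_raySup (hσ : Function.Bijective σ) (hh : Homogeneous σ α β)
    (hray : ∀ N : ℤ, 0 ≤ N → BrownConvergent σ (fun i => N * α i) (fun i => N * β i))
    {z : Fin (ℓ + 3) → ℝ} (hz : StrictMono z) : FRay σ α β z ≤ raySup σ α β := by
  rw [FRay_eq_rayF_nfT σ α β hσ hh hz]
  exact rayF_le_raySup σ α β hσ hh hray (nfT_mem hz)

end Summit.KontsevichZagierPeriods.Zeta5Search.Families.Cellular
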